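import Mathlib
import Summits.QuantumAdvantage.QuantumAdvantage.Theses.SpinorFlattening
import Literature.Computability.QuantumComplexity.GaussianRank

/-!
# Sketch — crux `SpinorFlattening.GaussRankPolyImpliesPPoly` (stmt-QuantumAdvantage-1247), ideator 3, round 1

First lemmas of the three idea cards (kill-first-exfalso, uniform-outcome-hitting-set,
fourier-orbit-deconditioning). Items 1–2 are PROVED (no sorry); the rest are `Prop`s that must
elaborate over existing declarations.
-/

noncomputable section

namespace Summit.QuantumAdvantage.QuantumAdvantage.Cruxes.GaussRankPolyImpliesPPoly.Ideator3

open Summit.QuantumAdvantage.QuantumAdvantage.Theses.SpinorFlattening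
open Literature.Computability.QuantumComplexity Literature.Computability.Cryptography
open scoped BigOperators Matrix
open Matrix

/-! ## Card A — kill-first-exfalso -/

/-- The kill item refutes the target (the inline `let`s of the two decls are syntactically equal). -/
theorem neg_thesis_of_kill (hK : NegApproxGaussRankSuperpoly) : ¬ GaussRankPolyThesis := by
  intro hX
  obtain ⟨δ, hδ0, _hδ1, H⟩ := hK
  obtain ⟨c, hc⟩ := hX δ hδ0
  obtain ⟨t, ht⟩ := H c
  obtain ⟨r, hr, a, g, hg, hle⟩ := hc t
  exact lt_irrefl _ ((ht r hr a g hg).trans_le hle)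

/-- Card A's whole line: the crux is vacuous once the kill item lands. -/
theorem crux_of_kill (hK : NegApproxGaussRankSuperpoly) : GaussRankPolyImpliesPPoly :=
  fun hX => absurd hX (neg_thesis_of_kill hK)

/-! ## Shared middle statement — the DE-CONDITIONED thesis (explicit coefficient bound) -/

/-- `GaussRankPolyBounded`: polynomial δ-approximate Gaussian rank of `|M⟩^{⊗t}` WITH unit Gaussian
terms and coefficients of modulus `≤ 2^(t^c + c)` (poly bit-size). This is the honest hypothesis a
simulation argument consumes; card C derives it from `GaussRankPolyThesis`, card B turns it into
`BQP ⊆ P/poly`. -/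
def GaussRankPolyBounded : Prop :=
  ∀ δ : ℝ, 0 < δ → ∃ c : ℕ, ∀ t : ℕ, ∃ r : ℕ, r ≤ t ^ c + c ∧
    ∃ (a : Fin r → ℂ) (g : Fin r → QReg (t * 4) → ℂ),
      (∀ i, IsGaussian (g i) ∧ normSq (g i) = 1 ∧ ‖a i‖ ≤ (2 : ℝ) ^ (t ^ c + c)) ∧
      normSq (magicMPow t - ∑ i, a i • g i) ≤ δ ^ 2

/-- Card C's load-bearing stub (conjectural): de-conditioning. -/
def Decondition : Prop := GaussRankPolyThesis → GaussRankPolyBounded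

/-- Card B's load-bearing stub: the free-standing packaging theorem with the honest hypothesis. -/
def BoundedRankSimulation : Prop :=
  GaussRankPolyBounded → BQP ⊆ Literature.Computability.Complexity.PPoly

/-- Composition of cards B + C concludes the crux BY NAME. -/
theorem crux_of_decondition_and_simulation (hC : Decondition) (hB : BoundedRankSimulation) :
    GaussRankPolyImpliesPPoly :=
  fun hX => hB (hC hX)

/-! ## Card B — uniform-outcome-hitting-set: first lemma (dictionary-agnostic sampler) -/

/-- HITTING MULTISET (Hoeffding + union bound over the `2^n` inputs): for any `[0,2]`-valued table
`f x y` (`x` = input of length `n`, `y` = gadget outcome record of length `m`) there are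
`k = 1600 (n+1)` outcome records whose empirical mean is within `1/20` of the uniform mean for EVERY
input `x` simultaneously. Only finite combinatorics/probability; no machine model. -/
def HittingMultiset : Prop :=
  ∀ (n m : ℕ) (f : (Fin n → Bool) → (Fin m → Bool) → ℝ),
    (∀ x y, 0 ≤ f x y ∧ f x y ≤ 2) →
    ∃ Y : Fin (1600 * (n + 1)) → (Fin m → Bool),
      ∀ x, |(∑ j, f x (Y j)) / (1600 * (n + 1) : ℝ) - (∑ y, f x y) / (2 : ℝ) ^ m| ≤ 1 / 20


/-! ## Card B — the 1245-IMMUNE quantitative form (pointwise size bound in the supplied decomposition) -/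

/-- CNOT placements of a Clifford+T circuit (the gates that cost one SWAP gadget / one `|M⟩` each in
the pair encoding). -/
def isCNOT {n : ℕ} : QGate cliffordT n → Bool
  | .gate .CNOT _ => true
  | .gate .H _ => false
  | .gate .S _ => false
  | .gate .T _ => false
  | .oracle _ _ => false

/-- The CNOT-count `h` of a Clifford+T circuit = number of magic copies `|M⟩^{⊗h}` consumed. -/
def cnotCount {n : ℕ} (C : QCircuit cliffordT n) : ℕ := C.gates.countP fun q => isCNOT q

/-- `RankSizeBound` (card uniform-outcome-hitting-set, durable form): the B₂-circuit size of any
Boolean function decided with gap (2/3, 1/3) by an oracle-free Clifford+T circuit is polynomial in the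
circuit size PLUS the size `r` and coefficient bit-bound `B` of WHATEVER unit-Gaussian
(1/50)-approximate decomposition of `|M⟩^{⊗ cnotCount}` is supplied. Immune to the kill item 1245 (it
quantifies over supplied decompositions, like `BravyiGosset2016_estimateAcceptProb` quantifies over the
actual stabilizer rank); `BoundedRankSimulation` is its corollary. -/
def RankSizeBound : Prop :=
  ∃ p : Polynomial ℕ, ∀ (n m : ℕ) (C : QCircuit cliffordT (n + m)), C.IsOracleFree →
    ∀ (r B : ℕ) (a : Fin r → ℂ) (g : Fin r → QReg (cnotCount C * 4) → ℂ),
      (∀ i, IsGaussian (g i) ∧ normSq (g i) = 1 ∧ ‖a i‖ ≤ (2 : ℝ) ^ B) →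
      normSq (magicMPow (cnotCount C) - ∑ i, a i • g i) ≤ (1 / 50 : ℝ) ^ 2 →
      ∀ f : (Fin n → Bool) → Bool,
        (∀ x, (f x = true → (2 / 3 : ℝ) ≤ C.acceptProb 0 x) ∧
              (f x = false → C.acceptProb 0 x ≤ (1 / 3 : ℝ))) →
        Literature.Computability.Complexity.circuitSizeOver Literature.Computability.Complexity.B2 f ≤
          p.eval (n + m + C.gates.length + r + B)

/-! ## Card C — fourier-orbit-deconditioning: first lemma (exact single-direction de-bordering) -/

/-- The pair-Dicke vector on `n` adjacent pairs of wires (`2l, 2l+1`): amplitude `1` on the bit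
strings that are constant on every pair and have exactly `k` pairs equal to `11`, else `0`.
It is the (normalised up to `√C(n,k)`) `k`-th jet of the Gaussian curve
`θ ↦ ⊗_l (cos θ |00⟩ + sin θ |11⟩)`, hence of BORDER Gaussian rank `≤ k+1`. -/
def pairDicke (n k : ℕ) : QReg (n * 2) → ℂ := fun x =>
  if (∀ l : Fin n, x (finProdFinEquiv (l, (0 : Fin 2))) = x (finProdFinEquiv (l, (1 : Fin 2)))) ∧
      (Finset.univ.filter fun l : Fin n => x (finProdFinEquiv (l, (0 : Fin 2))) = true).card = k
  then 1 else 0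

/-- FOMENKO / discrete gauge-angle projection: `pairDicke n k = (2^{n/2}/(n+1)) Σ_{j ≤ n} ω^{-jk} G(2πj/(n+1))`
with `G(φ) = ⊗_l (|00⟩ + e^{iφ}|11⟩)/√2` Gaussian, so the EXACT Gaussian rank is `≤ n + 1`
(versus the naive `C(n,k)` and the ill-conditioned border expression with `k+1` terms). -/
def PairDickeRankBound : Prop :=
  ∀ n k : ℕ, gaussianRank (pairDicke n k) ≤ n + 1

/-- The quantitative single-direction statement behind card C (Cauchy coefficient extraction on a
circle of `L` points; `E z` = the complex one-parameter Gaussian orbit through `g` generated by a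
sum of COMMUTING Majorana pair monomials with weights `μ`, written as a finite product so that no
operator exponential is needed): every Taylor coefficient of the orbit is an `L`-term Gaussian
combination with coefficients of polynomial bit-size, up to error `η`. -/
def SingleDirectionDeborder : Prop :=
  ∀ (N : ℕ) (g : QReg N → ℂ), IsGaussian g → normSq g = 1 →
  ∀ (P : ℕ) (idx : Fin P → (Fin N × Bool) × (Fin N × Bool)) (μ : Fin P → ℝ),
    (∀ l, (idx l).1 ≠ (idx l).2) →
    (∀ l l', l ≠ l' → (idx l).1 ≠ (idx l').1 ∧ (idx l).1 ≠ (idx l').2 ∧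
        (idx l).2 ≠ (idx l').1 ∧ (idx l).2 ≠ (idx l').2) →
    (∀ l, |μ l| ≤ 1) →
    let m : Fin P → Matrix (QReg N) (QReg N) ℂ := fun l =>
      majorana N (idx l).1.1 (idx l).1.2 * majorana N (idx l).2.1 (idx l).2.2
    let E : ℂ → Matrix (QReg N) (QReg N) ℂ := fun z =>
      (List.ofFn fun l : Fin P => Complex.cos (z * μ l) • (1 : Matrix (QReg N) (QReg N) ℂ) +
        Complex.sin (z * μ l) • m l).prod
    let h : Matrix (QReg N) (QReg N) ℂ := ∑ l, (μ l : ℂ) • m l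
    ∀ (k : ℕ) (η : ℝ), 0 < η → η ≤ 1 →
      ∃ L : ℕ, L ≤ (N + k + 2) ^ 4 * (Nat.clog 2 ⌈η⁻¹⌉₊ + 1) ∧
      ∃ (z : Fin L → ℂ) (b : Fin L → ℂ),
        (∀ j, ‖z j‖ = 1 ∧ ‖b j‖ ≤ (2 : ℝ) ^ ((N + k + 2) ^ 2)) ∧
        (∀ j, IsGaussian (E (z j) *ᵥ g)) ∧
        normSq ((h ^ k) *ᵥ g - ∑ j, b j • (E (z j) *ᵥ g)) ≤ η ^ 2

end Summit.QuantumAdvantage.QuantumAdvantage.Cruxes.GaussRankPolyImpliesPPoly.Ideator3
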